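import Mathlib

/-!
# Decomposable transport costs — the tree case of the Ollivier–Ricci curvature (DEQ-A156)

HONEST FRAMING: instance-level adjudication of specific advantage claims; no claim about BQP vs BPP
or the summit.

If the cost of moving mass from source `i` to sink `j` splits as `c i j = e i + C + f j`, then the cost
of ANY transport plan `γ` with row marginals `r` and column marginals `s` is
`∑ i, r i * e i + C * ∑ i, r i + ∑ j, s j * f j`. Hence any two feasible plans cost the same (‘any
feasible transport is optimal’), and for the uniform marginals `1/p`, `1/q` used in Ollivier's
curvature of an edge `(x, y)` of a weighted TREE — where `d_G(x_i, y_j) = d(x_i, x) + d(x, y) + d(y, y_j)`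
— the 1-Wasserstein cost is `(∑ e) / p + C + (∑ f) / q`: eq. (II.7) of Nghiem, Nguyen, Do, Wei, Phan,
‘Quantum Algorithm for Estimating Ollivier-Ricci Curvature’, arXiv:2512.09822 (Phys. Rev. Research
2026), computed classically with `p + q + 1` look-ups of raw edge lengths and no dependence on the
number `N` of data points. No `sorry`, no new axioms; Mathlib only.
-/

namespace Summit.QuantumAdvantage.Dequantization.DecomposableTransport

open Finset BigOperators

variable {ι κ : Type*} [Fintype ι] [Fintype κ]

/-- The cost `∑_{i,j} γ_{ij} c_{ij}` of a transport plan `γ` under the cost table `c`. -/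
def planCost (γ : ι → κ → ℝ) (c : ι → κ → ℝ) : ℝ := ∑ i, ∑ j, γ i j * c i j

/-- A decomposable cost table. -/
def decomposable (e : ι → ℝ) (C : ℝ) (f : κ → ℝ) : ι → κ → ℝ := fun i j => e i + C + f j

/-- For a decomposable cost, the cost of a plan depends only on its marginals. -/
theorem planCost_decomposable (γ : ι → κ → ℝ) (e : ι → ℝ) (C : ℝ) (f : κ → ℝ)
    (r : ι → ℝ) (s : κ → ℝ)
    (hrow : ∀ i, ∑ j, γ i j = r i) (hcol : ∀ j, ∑ i, γ i j = s j) :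
    planCost γ (decomposable e C f) = ∑ i, r i * e i + C * ∑ i, r i + ∑ j, s j * f j := by
  unfold planCost decomposable
  have h1 : ∀ i, ∑ j, γ i j * (e i + C + f j) = r i * e i + C * r i + ∑ j, γ i j * f j := by
    intro i
    have : ∑ j, γ i j * (e i + C + f j) = (∑ j, γ i j) * e i + C * (∑ j, γ i j) + ∑ j, γ i j * f j := by
      rw [Finset.sum_mul, Finset.mul_sum, ← Finset.sum_add_distrib, ← Finset.sum_add_distrib]
      refine Finset.sum_congr rfl ?_
      intro j _
      ring
    rw [this, hrow i]
  have h2 : ∑ i, ∑ j, γ i j * f j = ∑ j, s j * f j := by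
    rw [Finset.sum_comm]
    refine Finset.sum_congr rfl ?_
    intro j _
    rw [← Finset.sum_mul, hcol j]
  simp only [h1, Finset.sum_add_distrib, h2, ← Finset.mul_sum]

/-- ‘Any feasible transport is optimal’: two plans with the same marginals have the same cost. -/
theorem planCost_eq_of_same_marginals (γ γ' : ι → κ → ℝ) (e : ι → ℝ) (C : ℝ) (f : κ → ℝ)
    (r : ι → ℝ) (s : κ → ℝ)
    (hrow : ∀ i, ∑ j, γ i j = r i) (hcol : ∀ j, ∑ i, γ i j = s j)
    (hrow' : ∀ i, ∑ j, γ' i j = r i) (hcol' : ∀ j, ∑ i, γ' i j = s j) :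
    planCost γ (decomposable e C f) = planCost γ' (decomposable e C f) := by
  rw [planCost_decomposable γ e C f r s hrow hcol, planCost_decomposable γ' e C f r s hrow' hcol']

/-- The Ollivier–Ricci tree formula: with uniform marginals `1/p` on the `p` sources and `1/q` on the
`q` sinks, every feasible plan costs `(∑ e)/p + C + (∑ f)/q` (eq. (II.7) of arXiv:2512.09822 with
`e i = d(x_i, x)`, `C = d(x, y)`, `f j = d(y, y_j)`). -/
theorem planCost_uniform (γ : ι → κ → ℝ) (e : ι → ℝ) (C : ℝ) (f : κ → ℝ)
    (hp : 0 < Fintype.card ι)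
    (hrow : ∀ i, ∑ j, γ i j = 1 / (Fintype.card ι : ℝ))
    (hcol : ∀ j, ∑ i, γ i j = 1 / (Fintype.card κ : ℝ)) :
    planCost γ (decomposable e C f) =
      (∑ i, e i) / (Fintype.card ι : ℝ) + C + (∑ j, f j) / (Fintype.card κ : ℝ) := by
  rw [planCost_decomposable γ e C f (fun _ => 1 / (Fintype.card ι : ℝ))
        (fun _ => 1 / (Fintype.card κ : ℝ)) hrow hcol]
  have hp' : (Fintype.card ι : ℝ) ≠ 0 := by exact_mod_cast hp.ne'
  simp only [Finset.sum_const, Finset.card_univ, nsmul_eq_mul, ← Finset.mul_sum]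
  field_simp

/-- The uniform product plan is feasible, so the common value above is attained (the feasible set
is non-empty whenever `p, q ≥ 1`). -/
theorem productPlan_feasible (hp : 0 < Fintype.card ι) (hq : 0 < Fintype.card κ) :
    (∀ _i : ι, ∑ _j : κ, (1 / ((Fintype.card ι : ℝ) * (Fintype.card κ : ℝ))) = 1 / (Fintype.card ι : ℝ)) ∧
    (∀ _j : κ, ∑ _i : ι, (1 / ((Fintype.card ι : ℝ) * (Fintype.card κ : ℝ))) = 1 / (Fintype.card κ : ℝ)) := by
  have hp' : (Fintype.card ι : ℝ) ≠ 0 := by exact_mod_cast hp.ne'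
  have hq' : (Fintype.card κ : ℝ) ≠ 0 := by exact_mod_cast hq.ne'
  constructor
  · intro _
    simp only [Finset.sum_const, Finset.card_univ, nsmul_eq_mul]
    field_simp
  · intro _
    simp only [Finset.sum_const, Finset.card_univ, nsmul_eq_mul]
    field_simp

/-- Worked instance (Appendix A of arXiv:2512.09822 is NOT decomposable; here the decomposable
sanity case): two sources, two sinks, `e = (1, 3)`, `C = 1`, `f = (2, 4)`; every feasible plan costs
`(1+3)/2 + 1 + (2+4)/2 = 6`. -/
example (γ : Fin 2 → Fin 2 → ℝ)
    (hrow : ∀ i, ∑ j, γ i j = 1 / (Fintype.card (Fin 2) : ℝ))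
    (hcol : ∀ j, ∑ i, γ i j = 1 / (Fintype.card (Fin 2) : ℝ)) :
    planCost γ (decomposable ![1, 3] 1 ![2, 4]) = 6 := by
  rw [planCost_uniform γ _ _ _ (by simp) hrow hcol]
  simp [Fin.sum_univ_two]
  norm_num

end Summit.QuantumAdvantage.Dequantization.DecomposableTransport
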